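import Summits.CriticalPhenomena.PercolationContinuityZ3.Theorems.Transplant.SkelPhiFaceNumsMkX4EV
import Summits.CriticalPhenomena.PercolationContinuityZ3.Theorems.Transplant.SkelPhiQStepsN
import HarnessLib
/-!
# WAVE-Q binder row «SkelPhiFaceNumsMkX4EV» ↦ «SkelPhiFaceNumsMkX4EVQ» (quasi-step rung (N3-b); captain gen-1 g4, WAVE-Q-BINDER-rows v0.7/v0.8; family stmt-g33 = «SkelPhiCorridor*» / «SkelPhiFace*»):
# **THE SMART CONSTRUCTOR OF THE PER-CENTRE NUMBERS AT AN x-FACE (v4, EV) UNDER EXACT-FOOTPRINT QUASI-STEPS** — `Skelφ.faceRunNumsX4_mkEVQ`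

builds on p205010 (kernel theorem, internal audit signed; external expert review pending) — nothing in this file uses p205010; nothing here is a claim about any open node (the
quasi-step node's statement, name and wording are a lead's).  Lane `prim-bschramm`, seat `prim-bschramm-stmt` gen 33 (port pen).  Helper file (`--supports stmt-CriticalPhenomena-4575 --as helper`);
def-free.  PORT RULES (captain #6109/#6122 hunk classes): the declarations below are the `Steps ↦ QStepsN` twins of the `hstep`-threading declarations of the tree module «SkelPhiFaceNumsMkX4EV»
(sha256 e4f9fc5681951cff…, imported — every Steps-free resident stays available from it), statements and proofs BYTE-IDENTICAL except: (i) the binder `(hstep : Steps G φ) ↦ {M : ℕ} (hq : Skelφ.QStepsN G φ M)`;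
(ii)/(iv) the run origins `cL`, `cT` come from «SkelPhiQStepsN» `QStepsN.exists_mem_graphBall_eq hq` (in place of `exists_mem_graphBall_φ_eq hstep`), so the recorded radii are `RcL := M·‖yL‖₁`, `RcT := M·‖yT‖₁` and the two floor hypotheses read `hπ2X : M·‖yL‖₁ + (Nr+1)·shearUnit ≤ r`, `hπ3X : ∀ k ≤ N₃, M·‖yT‖₁ + (column radius k) ≤ r` (FLOOR row: ×M on the run-origin radii only; the column term keeps the structure's shape — p5-g28's pull list)..  Regression (manifest §2): at `M = 1` (`Skelφ.qStepsN_of_steps`) each statement is the original's.  Docstrings and citations are the original's.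
-/
noncomputable section

open scoped Classical

namespace Summit.CriticalPhenomena.PercolationContinuityZ3.Theorems.Transplant

namespace Skelφ

open Literature.Probability.Percolation Literature.Probability.LatticeModels SimpleGraph KNCells
open Literature.Probability.Percolation.KozmaNitzan
open Literature.Probability.Percolation.KozmaNitzan.Cells (oth oth_ne sgOf sgOf_sign stepVec_apply_fst eq_oth_of_ne oth_oth)
open KNLevels ChainPlanar ChainPara
open Literature.Barriers.CriticalPhenomena (graphBall mem_graphBall_self graphBall_mono)
open BoxProdZ2 (ConcRadiiG)
open TwoAxis.Para (modulus)

variable {V : Type} [DecidableEq V] {G : SimpleGraph V} [G.LocallyFinite] {φ : V → Site 2}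

/-- **THE SMART CONSTRUCTOR OF THE PER-CENTRE NUMBERS AT AN x-FACE, v4** (see the module docstring). -/
theorem faceRunNumsX4_mkEVQ {M : ℕ} (hq : QStepsN G φ M) (pr : FinePrm) (w₀ : V) {nL : ℕ} (hn : pr.n = nL) (hnL : 1 ≤ nL) (hvL : |pr.vα| ≤ nL)
    (hD : 0 < pr.D) (hlipψ : Lip G (pr.ψ φ w₀)) (hws : WeakSteps G (pr.ψ φ w₀))
    (P : PCells2V) (Λ : ConcRadiiG) (b₀ : Fin 2 → ℕ) (a' : ℕ) (x : Site 2) (du : MDir) (j : ℕ) {L' : ℕ} (hL' : 1 ≤ L')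
    (hrM : L' ≤ Λ.rM a' (x + stepVec du)) {k₀ : ℤ} (hk₀ : 0 ≤ k₀) {r : ℕ} (c : V) (hcw : c ∈ graphBall G w₀ (Λ.rE a' x du - r))
    (hrE : r ≤ Λ.rE a' x du) (Mz : ℕ)
    -- the contact's cell, the footprint boxes tied to it
    {Llo Lhi wc : ℤ} (hLlo : Llo ≤ P.lev du x (pr.ψ φ w₀ c)) (hLhi : P.lev du x (pr.ψ φ w₀ c) ≤ Lhi)
    (hwc : |pr.ψ φ w₀ c (oth du.1) - P.cenS x (oth du.1)| ≤ wc)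
    {flo fhi fw : ℤ} (hflo : 5 * (P.r du.1 : ℤ) + 10 * P.s du.1 * j + 3 ≤ flo + Llo) (hfhi : fhi + Lhi ≤ 25 * P.r du.1 - 2)
    (hfw : fw + wc + k₀ + 1 + P.c du.1 ≤ 5 * (P.r (oth du.1) : ℤ) - 3) {LLO LHI : Site 2}
    (hglo : ∀ i, P.cenS (x + stepVec du) i - b₀ i + 2 ≤ LLO i + pr.ψ φ w₀ c i) (hghi : ∀ i, LHI i + pr.ψ φ w₀ c i ≤ P.cenS (x + stepVec du) i + b₀ i - 2)
    {kpar kperp : ℤ} (hfR : flo ≤ -kpar ∧ kpar ≤ fhi ∧ kperp ≤ fw)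
    -- the near zone
    (Zc : Finset V) {kZ : ℤ} (hZk : ∀ v ∈ Zc, |pr.ψ φ c v du.1| ≤ kZ) (hZfar : Lhi + kZ + 1 < 20 * (P.r du.1 : ℤ) - b₀ du.1)
    -- the run data
    (B : BridgePrm) (ℓ' R's qB R'₃ qB₃ : ℕ) (hlay : (nL + pr.h.natAbs : ℕ) ≤ (nL : ℤ) * ℓ' + 1) (yL yT : Site 2) (Nr N₃ : ℕ) {σT : ℤ}
    (hσT : σT = 1 ∨ σT = -1) (PLO PHI YLO YHI : ℕ → Site 2)
    {paLo pbLo paHi pbHi yaLo ybLo yaHi ybHi : ℕ → ℤ} {laLo lbLo laHi lbHi : ℤ}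
    (hreg : ∀ k ≤ Nr, (xRunSched nL ℓ' pr.h R's qB Nr).region k ⊆ Finset.Icc (pt (paLo k) (pbLo k)) (pt (paHi k) (pbHi k)))
    (hregY : ∀ k ≤ N₃, (yRunSched hnL hvL hlay R'₃ qB₃ N₃).region k ⊆ Finset.Icc (pt (yaLo k) (ybLo k)) (pt (yaHi k) (ybHi k)))
    (hlastc : (yRunSched hnL hvL hlay R'₃ qB₃ N₃).core (N₃ + 1) ⊆ Finset.Icc (pt laLo lbLo) (pt laHi lbHi))
    (hP0 : ∀ k ≤ Nr, PLO k 0 ≤ TwoAxis.Para.coarse pr.c₀ (pr.D / 2) pr.D (TwoAxis.Para.lam0 pr.A pr.vα pr.vβ yL) +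
      (pr.c₀ * (pr.A * (modulus nL pr.h pr.vα pr.vβ * (min (sgOf du * paLo k) (sgOf du * paHi k)) -
      max (pr.vα * ((shearUnit nL pr.h : ℤ) * (min (sgOf du * pbLo k) (sgOf du * pbHi k) - 1)))
      (pr.vα * ((shearUnit nL pr.h : ℤ) * (max (sgOf du * pbLo k) (sgOf du * pbHi k)) + shearUnit nL pr.h - 1))) / nL)) / pr.D)
    (hP1 : ∀ k ≤ Nr, TwoAxis.Para.coarse pr.c₀ (pr.D / 2) pr.D (TwoAxis.Para.lam0 pr.A pr.vα pr.vβ yL) +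
      (pr.c₀ * (pr.A * (modulus nL pr.h pr.vα pr.vβ * (max (sgOf du * paLo k) (sgOf du * paHi k)) -
      min (pr.vα * ((shearUnit nL pr.h : ℤ) * (min (sgOf du * pbLo k) (sgOf du * pbHi k) - 1)))
      (pr.vα * ((shearUnit nL pr.h : ℤ) * (max (sgOf du * pbLo k) (sgOf du * pbHi k)) + shearUnit nL pr.h - 1))) / nL)) / pr.D
      + 1 ≤ PHI k 0)
    (hP2 : ∀ k ≤ Nr, PLO k 1 ≤ TwoAxis.Para.coarse pr.c₁ (pr.D / 2) pr.D (TwoAxis.Para.lam1 pr.A nL pr.h yL) +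
      (pr.c₁ * (pr.A * ((shearUnit nL pr.h : ℤ) * (min (sgOf du * pbLo k) (sgOf du * pbHi k) - 1)))) / pr.D)
    (hP3 : ∀ k ≤ Nr, TwoAxis.Para.coarse pr.c₁ (pr.D / 2) pr.D (TwoAxis.Para.lam1 pr.A nL pr.h yL) +
      (pr.c₁ * (pr.A * ((shearUnit nL pr.h : ℤ) * (max (sgOf du * pbLo k) (sgOf du * pbHi k)) + shearUnit nL pr.h - 1))) / pr.D + 1
      ≤ PHI k 1)
    (hPf₁ : ∀ k ≤ Nr, sgOf du = 1 → flo ≤ PLO k du.1 ∧ PHI k du.1 ≤ fhi)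
    (hPf₂ : ∀ k ≤ Nr, sgOf du = -1 → flo ≤ -PHI k du.1 ∧ -PLO k du.1 ≤ fhi)
    (hPf₃ : ∀ k ≤ Nr, -fw ≤ PLO k (oth du.1) ∧ PHI k (oth du.1) ≤ fw)
    (hY0 : ∀ k ≤ N₃, YLO k 0 ≤ TwoAxis.Para.coarse pr.c₀ (pr.D / 2) pr.D (TwoAxis.Para.lam0 pr.A pr.vα pr.vβ yT) +
      (pr.c₀ * (pr.A * (modulus nL pr.h pr.vα pr.vβ * (min (σT * ybLo k) (σT * ybHi k)) -
      max (pr.vα * ((shearUnit nL pr.h : ℤ) * (min (σT * yaLo k) (σT * yaHi k) - 1)))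
      (pr.vα * ((shearUnit nL pr.h : ℤ) * (max (σT * yaLo k) (σT * yaHi k)) + shearUnit nL pr.h - 1))) / nL)) / pr.D)
    (hY1 : ∀ k ≤ N₃, TwoAxis.Para.coarse pr.c₀ (pr.D / 2) pr.D (TwoAxis.Para.lam0 pr.A pr.vα pr.vβ yT) +
      (pr.c₀ * (pr.A * (modulus nL pr.h pr.vα pr.vβ * (max (σT * ybLo k) (σT * ybHi k)) -
      min (pr.vα * ((shearUnit nL pr.h : ℤ) * (min (σT * yaLo k) (σT * yaHi k) - 1)))
      (pr.vα * ((shearUnit nL pr.h : ℤ) * (max (σT * yaLo k) (σT * yaHi k)) + shearUnit nL pr.h - 1))) / nL)) / pr.D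
      + 1 ≤ YHI k 0)
    (hY2 : ∀ k ≤ N₃, YLO k 1 ≤ TwoAxis.Para.coarse pr.c₁ (pr.D / 2) pr.D (TwoAxis.Para.lam1 pr.A nL pr.h yT) +
      (pr.c₁ * (pr.A * ((shearUnit nL pr.h : ℤ) * (min (σT * yaLo k) (σT * yaHi k) - 1)))) / pr.D)
    (hY3 : ∀ k ≤ N₃, TwoAxis.Para.coarse pr.c₁ (pr.D / 2) pr.D (TwoAxis.Para.lam1 pr.A nL pr.h yT) +
      (pr.c₁ * (pr.A * ((shearUnit nL pr.h : ℤ) * (max (σT * yaLo k) (σT * yaHi k)) + shearUnit nL pr.h - 1))) / pr.D + 1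
      ≤ YHI k 1)
    (hYf₁ : ∀ k ≤ N₃, sgOf du = 1 → flo ≤ YLO k du.1 ∧ YHI k du.1 ≤ fhi)
    (hYf₂ : ∀ k ≤ N₃, sgOf du = -1 → flo ≤ -YHI k du.1 ∧ -YLO k du.1 ≤ fhi)
    (hYf₃ : ∀ k ≤ N₃, -fw ≤ YLO k (oth du.1) ∧ YHI k (oth du.1) ≤ fw)
    (hL0 : LLO 0 ≤ TwoAxis.Para.coarse pr.c₀ (pr.D / 2) pr.D (TwoAxis.Para.lam0 pr.A pr.vα pr.vβ yT) +
      (pr.c₀ * (pr.A * (modulus nL pr.h pr.vα pr.vβ * (min (σT * lbLo) (σT * lbHi)) -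
      max (pr.vα * ((shearUnit nL pr.h : ℤ) * (min (σT * laLo) (σT * laHi) - 1)))
      (pr.vα * ((shearUnit nL pr.h : ℤ) * (max (σT * laLo) (σT * laHi)) + shearUnit nL pr.h - 1))) / nL)) / pr.D)
    (hL1 : TwoAxis.Para.coarse pr.c₀ (pr.D / 2) pr.D (TwoAxis.Para.lam0 pr.A pr.vα pr.vβ yT) +
      (pr.c₀ * (pr.A * (modulus nL pr.h pr.vα pr.vβ * (max (σT * lbLo) (σT * lbHi)) -
      min (pr.vα * ((shearUnit nL pr.h : ℤ) * (min (σT * laLo) (σT * laHi) - 1)))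
      (pr.vα * ((shearUnit nL pr.h : ℤ) * (max (σT * laLo) (σT * laHi)) + shearUnit nL pr.h - 1))) / nL)) / pr.D
      + 1 ≤ LHI 0)
    (hL2 : LLO 1 ≤ TwoAxis.Para.coarse pr.c₁ (pr.D / 2) pr.D (TwoAxis.Para.lam1 pr.A nL pr.h yT) +
      (pr.c₁ * (pr.A * ((shearUnit nL pr.h : ℤ) * (min (σT * laLo) (σT * laHi) - 1)))) / pr.D)
    (hL3 : TwoAxis.Para.coarse pr.c₁ (pr.D / 2) pr.D (TwoAxis.Para.lam1 pr.A nL pr.h yT) +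
      (pr.c₁ * (pr.A * ((shearUnit nL pr.h : ℤ) * (max (σT * laLo) (σT * laHi)) + shearUnit nL pr.h - 1))) / pr.D + 1
      ≤ LHI 1)
    (hxaX : ∀ x ∈ Finset.Icc B.core1Lo B.core1Hi, |x 0 - sgOf du * yL 0| ≤ qB)
    (hxbX : ∀ x ∈ Finset.Icc B.core1Lo B.core1Hi,
      |sgOf du * ((nL : ℤ) * (x 1 - yL 1) - pr.h * (sgOf du * x 0 - yL 0))| + shearUnit nL pr.h ≤ ((nL * ℓ' / shearUnit nL pr.h + 1 : ℕ) : ℤ) * shearUnit nL pr.h)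
    (hxyX : ∀ a s : ℤ, (xPrmW nL ℓ' pr.h R's qB Nr).aLo (Nr + 1) ≤ a → a ≤ (xPrmW nL ℓ' pr.h R's qB Nr).aHi (Nr + 1) →
      (xPrmW nL ℓ' pr.h R's qB Nr).bLo (Nr + 1) ≤ s / (shearUnit nL pr.h : ℤ) → s / (shearUnit nL pr.h : ℤ) ≤ (xPrmW nL ℓ' pr.h R's qB Nr).bHi (Nr + 1) →
      (yPrmW nL ℓ' pr.h pr.vα R'₃ qB₃ N₃).InCore 0 ((σT * sgOf du * s - σT * ((nL : ℤ) * (yT - yL) 1 - pr.h * (yT - yL) 0)) / (shearUnit nL pr.h : ℤ))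
      (σT * sgOf du * a - σT * (yT - yL) 0))
    -- seed clearances: along x-run by the α-floor; tangential y′-run per region by the α-floor OR the level floor
    (hclr : ∀ k ≤ Nr, (Mz : ℤ) < paLo k + sgOf du * yL 0)
    (hclr₃ : ∀ k ≤ N₃, (∀ b : ℤ, min (σT * ybLo k) (σT * ybHi k) ≤ b → b ≤ max (σT * ybLo k) (σT * ybHi k) → (Mz : ℤ) < sgOf du * (b + yT 0)) ∨
      ((shearUnit nL pr.h : ℤ) * Mz + |(nL : ℤ) * yT 1 - pr.h * yT 0| < (shearUnit nL pr.h : ℤ) * yaLo k))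
    (hπ2X : M * ((yL 0).natAbs + (yL 1).natAbs) + (Nr + 1) * shearUnit nL pr.h ≤ r)
    (hπ3X : ∀ k ≤ N₃, M * ((yT 0).natAbs + (yT 1).natAbs) + (((((k + 1 : ℕ) : ℤ) * pr.vα).natAbs +
      (((shearUnit nL pr.h : ℤ) * |((k + 1 : ℕ) : ℤ) * (yPrmW nL ℓ' pr.h pr.vα R'₃ qB₃ N₃).sLo| + |pr.h| * |((k + 1 : ℕ) : ℤ) * pr.vα| + shearUnit nL pr.h) / nL).natAbs + 1))
      ≤ r)
    : ∃ N : FaceRunNumsX4 G φ (pr.ψ φ w₀) c pr.A nL pr.h pr.vα pr.vβ pr.c₀ pr.c₁ pr.D du (sgOf du) B ℓ' R's qB R'₃ qB₃ pr.vα hnL hvL hlay Mz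
        (P.farCore x du j k₀) (targetMMV G φ pr P w₀ Λ b₀ a' x du L') Zc r kpar kperp, N.Nr = Nr ∧ N.N₃ = N₃ ∧ N.σT = σT := by
  have hσ : sgOf du = 1 ∨ sgOf du = -1 := sgOf_sign du
  have hσabs : |sgOf du| = 1 := by rcases hσ with h | h <;> simp [h]
  -- the fine maps in the structure's spelling
  have eψ : ∀ t, pr.ψ φ t = fineSkel φ t pr.A (nL : ℤ) pr.h pr.vα pr.vβ pr.c₀ pr.c₁ (pr.D / 2) (pr.D / 2) pr.D := fun t => by
    simp only [FinePrm.ψ, hn]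
  -- the run origins
  obtain ⟨cL, hcLπ, hcLφ⟩ := QStepsN.exists_mem_graphBall_eq hq c (φ c + yL)
  obtain ⟨cT, hcTπ, hcTφ⟩ := QStepsN.exists_mem_graphBall_eq hq c (φ c + yT)
  simp only [Pi.add_apply, add_sub_cancel_left] at hcLπ hcTπ
  -- the inner ball inside the outer ball
  have hball : ∀ {w : V}, w ∈ graphBall G c r → w ∈ graphBall G w₀ (Λ.rE a' x du) := by
    intro w hw
    have h2 := BoxProdZ2.mem_graphBall_add G hcw hw
    rwa [Nat.sub_add_cancel hrE] at h2
  refine ⟨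
    { cL := cL,
      cT := cT,
      yL := yL,
      yT := yT,
      RcL := M * ((yL 0).natAbs + (yL 1).natAbs),
      RcT := M * ((yT 0).natAbs + (yT 1).natAbs),
      Nr := Nr,
      N₃ := N₃,
      σT := σT,
      flo := flo,
      fhi := fhi,
      fw := fw,
      paLo := paLo,
      pbLo := pbLo,
      paHi := paHi,
      pbHi := pbHi,
      PLO := PLO,
      PHI := PHI,
      yaLo := yaLo,
      ybLo := ybLo,
      yaHi := yaHi,
      ybHi := ybHi,
      laLo := laLo,
      lbLo := lbLo,
      laHi := laHi,
      lbHi := lbHi,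
      YLO := YLO,
      YHI := YHI,
      LLO := LLO,
      LHI := LHI,
      hcLφ := hcLφ,
      hcTφ := hcTφ,
      hcLπ := hcLπ,
      hcTπ := hcTπ,
      hσT := hσT,
      hPlfoot := fun w _ hfb => ?_,
      hMfoot := fun w hw hfb => ?_,
      hMZ := ?_,
      hfR := hfR,
      hreg := hreg,
      hregY := hregY,
      hlastc := hlastc,
      hP0 := hP0,
      hP1 := hP1,
      hP2 := hP2,
      hP3 := hP3,
      hPf₁ := hPf₁,
      hPf₂ := hPf₂,
      hPf₃ := hPf₃,
      hY0 := hY0,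
      hY1 := hY1,
      hY2 := hY2,
      hY3 := hY3,
      hYf₁ := hYf₁,
      hYf₂ := hYf₂,
      hYf₃ := hYf₃,
      hL0 := hL0,
      hL1 := hL1,
      hL2 := hL2,
      hL3 := hL3,
      hxa := hxaX,
      hxb := hxbX,
      hxy := hxyX,
      hclrA := fun S hS k hk w hw hwS => ?_,
      hclrT := fun S hS k hk w hw => ?_,
      hπ2 := hπ2X,
      hπ3 := hπ3X }, rfl, rfl, rfl⟩
  · -- habitat conversion
    rw [eψ w₀]
    rw [eψ w₀] at hwc hLlo hLhi
    exact mem_farCore_of_footBoxV P w₀ c w pr.A (nL : ℤ) pr.h pr.vα pr.vβ pr.c₀ pr.c₁ hD hk₀ hfb hwc (by linarith) (by linarith) (by linarith)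
  · -- target conversion
    rw [← eψ c] at hfb
    exact mem_targetMM_of_cellBoxV c hL' hrM hD hlipψ hws (hball hw) hfb hglo hghi
  · -- the target is off the zone
    exact disjoint_targetMM_of_nearV c hD hZk hLhi hZfar
  · -- the along x-run is α-clear of the seed (bridge offset)
    have hb := hreg k hk hw
    rw [mem_Icc_pt_iff] at hb
    have h0 : paLo k ≤ sgOf du * (φ w 0 - φ c 0) - sgOf du * yL 0 := by
      have h := hb.1.1
      rw [runX_zero, relCoord_apply, hcLφ, Pi.add_apply] at h
      linarith
    have hs := hS w hwS
    rw [mem_box] at hs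
    have hs0 := hs 0
    simp only [Pi.sub_apply] at hs0
    have ha : sgOf du * (φ w 0 - φ c 0) ≤ Mz := by
      have h1 : |sgOf du * (φ w 0 - φ c 0)| ≤ Mz := by rw [abs_mul, hσabs, one_mul]; exact abs_le.2 ⟨hs0.1, hs0.2⟩
      exact (le_abs_self _).trans h1
    have hck := hclr k hk
    linarith
  · -- the tangential y′-run is clear of the seed, region by region: by α or by level
    have hb := hregY k hk hw
    rw [mem_Icc_pt_iff] at hb
    rcases hclr₃ k hk with hα | hlev
    · intro hwS
      have hs := hS w hwS
      rw [mem_box] at hs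
      have hs0 := hs 0
      simp only [Pi.sub_apply] at hs0
      have ha : sgOf du * (φ w 0 - φ c 0) ≤ Mz := by
        have h1 : |sgOf du * (φ w 0 - φ c 0)| ≤ Mz := by rw [abs_mul, hσabs, one_mul]; exact abs_le.2 ⟨hs0.1, hs0.2⟩
        exact (le_abs_self _).trans h1
      have h1 := hb.2.1
      have h2 := hb.2.2
      rw [runY_one, relCoord_apply] at h1 h2
      have key : (Mz : ℤ) < sgOf du * ((φ w 0 - φ cT 0) + yT 0) := by
        refine hα (φ w 0 - φ cT 0) ?_ ?_
        · rcases hσT with hT | hT <;> subst hT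
          · exact (min_le_left _ _).trans (by linarith)
          · exact (min_le_right _ _).trans (by linarith)
        · rcases hσT with hT | hT <;> subst hT
          · exact le_trans (by linarith) (le_max_right _ _)
          · exact le_trans (by linarith) (le_max_left _ _)
      rw [hcTφ, Pi.add_apply] at key
      have e : φ w 0 - (φ c 0 + yT 0) + yT 0 = φ w 0 - φ c 0 := by ring
      rw [e] at key
      linarith
    · refine not_mem_seed_of_level_runY hS hnL cT pr.h hσT (B := |(nL : ℤ) * yT 1 - pr.h * yT 0|) (le_of_eq ?_) hb.1.1 hlev
      rw [shearCoord_apply, hcTφ, Pi.add_apply, Pi.add_apply]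
      congr 1; ring

end Skelφ

end Summit.CriticalPhenomena.PercolationContinuityZ3.Theorems.Transplant

end
-- build-touch 2026-08-25T09:23Z T1-C (lead g18): re-land of p395859, declarations byte-identical
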